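import Literature.Analysis.FluidPDE.HardSphereFlowJointMeasurable
import Literature.Analysis.FluidPDE.HardSphereTrajectoryMeasurable
import Summits.AtomisticToContinuum.HydrodynamicLimit.Theorems.RelayRaceLocalityRestartPrincipleMeanClosureTools
import Summits.AtomisticToContinuum.HydrodynamicLimit.Theorems.AnnealedZeroHorizonMeanFluxClosureDeviatoricStressClosure
import HarnessLib

/-!
# Crux `MeanFluxClosure` (stmt-AtomisticToContinuum-9256), line `registered` — stub KS-b
# (deviatoric kinetic-stress closure), part 2: integrability at every `N` and the uniform
# mean bound

Support file (`--supports stmt-AtomisticToContinuum-9256`) for the stub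
`stub_deviatoricStressClosure` (KS-b) of the lead's skeleton of
`Summit.AtomisticToContinuum.HydrodynamicLimit.Theses.AnnealedZeroHorizon.MeanFluxClosure`,
continuing `AnnealedZeroHorizonMeanFluxClosureDeviatoricStressClosure.lean` (the exact identity
and the pointwise bounds). Here:

* `measurable_idealObservable` — the ideal-stress observable `w ↦ ∫_x J-integrand(w, x) dx` is
  measurable (jointly measurable integrand, `StronglyMeasurable.integral_prod_right'`);
* `abs_window_le` — pathwise, on the good set, `|T_φ − J_φ| ≤ 19 C (t₂ − t₁)(N+1)⁻¹Σ_a‖v_a(0)‖²`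
  (energy conservation `sum_norm_sq_vel_flow`);
* `stub_deviatoricStressClosure_integrable` (registered sub-goal) — **the integrability conjunct
  of the stub at every `N`** with the uniform bound `|E D| ≤ 19 C (t₂ − t₁)(3 sup θ₀ + sup‖u₀‖²)`,
  for `σ ≤ 1/2`, the functional `D` as in the stub with the `let`s written out (definitionally the
  stub's `D`, so its first conjunct is closed by `exact (… D hD).1`), via `integrable_avg_norm_sq_vel_flow`,
  `lintegral_avg_norm_sq_vel_le`, `HardSphereFlow.aemeasurable_intervalIntegral_comp_flow_torus`;
* `exists_forall_abs_partialDeriv_le` — the constant `C = sup_ij‖∂_jφ_i‖_∞` exists for smooth `φ`.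

What remains of the stub after this file is exactly its content: the smallness of the mean
`E ∫∫ Dev:∇φ` eventually in `N` at fixed `k` — isotropy IN MEAN of the scale-`ℓ` peculiar
stress along the deterministic hard-sphere dynamics at positive times (local equilibrium in its
weakest, annealed quadratic form; Boltzmann-hypothesis strength, no theorem in print).
No definitions. References: H. Spohn, *Large Scale Dynamics of Interacting Particles* (1991),
Part I Ch. 3.
-/

noncomputable section

namespace Summit.AtomisticToContinuum.HydrodynamicLimit.Theorems

open scoped BigOperators ENNReal Topology InnerProductSpace
open MeasureTheory Set Filter
open Literature.Analysis.FluidPDE Literature.Analysis.FunctionSpaces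
open Literature.MathematicalPhysics.KineticTheory

namespace DeviatoricStressClosure

/-! ### Measurability of the ideal-stress observable -/

/-- The mollified empirical density is jointly continuous in (configuration, base point).
[folklore] -/
theorem continuous_density_prod {n : ℕ} {k : T3 → ℝ} (hkc : Continuous k) :
    Continuous fun p : Config n (Fin 3) T3 × T3 =>
      empiricalDensityField p.1 (fun y => k (p.2 - y)) := by
  have h : (fun p : Config n (Fin 3) T3 × T3 => empiricalDensityField p.1 (fun y => k (p.2 - y))) =
      fun p => (n : ℝ)⁻¹ * ∑ a, k (p.2 - (p.1 a).1) :=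
    funext fun p => empiricalDensityField_eq_sum _ _
  rw [h]
  exact continuous_const.mul (continuous_finsetSum _ fun a _ => hkc.comp (by fun_prop))

/-- The mollified empirical momentum is jointly continuous in (configuration, base point).
[folklore] -/
theorem continuous_momentum_prod {n : ℕ} {k : T3 → ℝ} (hkc : Continuous k) :
    Continuous fun p : Config n (Fin 3) T3 × T3 =>
      empiricalMomentumField p.1 (fun y => k (p.2 - y)) := by
  have h : (fun p : Config n (Fin 3) T3 × T3 =>
      empiricalMomentumField p.1 (fun y => k (p.2 - y))) =
      fun p => (n : ℝ)⁻¹ • ∑ a, k (p.2 - (p.1 a).1) • (p.1 a).2 :=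
    funext fun p => empiricalMomentumField_eq_sum _ _
  rw [h]
  have hv : ∀ a : Fin n, Continuous fun p : Config n (Fin 3) T3 × T3 => (p.1 a).2 :=
    fun a => by fun_prop
  exact (continuous_finsetSum _ fun a _ => (hkc.comp (by fun_prop)).smul (hv a)).const_smul
    ((n : ℝ)⁻¹)

/-- The mollified empirical energy is jointly continuous in (configuration, base point).
[folklore] -/
theorem continuous_energy_prod {n : ℕ} {k : T3 → ℝ} (hkc : Continuous k) :
    Continuous fun p : Config n (Fin 3) T3 × T3 =>
      empiricalEnergyField p.1 (fun y => k (p.2 - y)) := by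
  have h : (fun p : Config n (Fin 3) T3 × T3 => empiricalEnergyField p.1 (fun y => k (p.2 - y))) =
      fun p => (n : ℝ)⁻¹ * ∑ a, k (p.2 - (p.1 a).1) * (‖(p.1 a).2‖ ^ 2 / 2) :=
    funext fun p => empiricalEnergyField_eq_sum _ _
  rw [h]
  have hv : ∀ a : Fin n, Continuous fun p : Config n (Fin 3) T3 × T3 => (p.1 a).2 :=
    fun a => by fun_prop
  exact continuous_const.mul (continuous_finsetSum _ fun a _ =>
    (hkc.comp (by fun_prop)).mul (((hv a).norm.pow 2).div_const 2))

/-- **The ideal-stress integrand is jointly measurable** in (configuration, base point): the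
mollified fields are continuous in `(w, x)` and division is measurable. [folklore] -/
theorem measurable_idealIntegrand {n : ℕ} {k : T3 → ℝ} (hkc : Continuous k) {φ : T3 → V3}
    (hφ : Torus.IsSmooth φ) :
    Measurable fun p : Config n (Fin 3) T3 × T3 =>
      (let R : ℝ := empiricalDensityField p.1 (fun y => k (p.2 - y))
      let Mv : V3 := empiricalMomentumField p.1 (fun y => k (p.2 - y))
      let En : ℝ := empiricalEnergyField p.1 (fun y => k (p.2 - y))
      let Θ : ℝ := 2 / 3 * (En / R - ‖Mv‖ ^ 2 / (2 * R ^ 2))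
      (∑ i, ∑ j, (Mv i * Mv j / R) * Torus.partialDeriv j (fun y => φ y i) p.2) +
        R * Θ * Torus.divergence φ p.2) := by
  haveI : OpensMeasurableSpace (Config n (Fin 3) T3 × T3) := Prod.opensMeasurableSpace
  have mR := (continuous_density_prod (n := n) hkc).measurable
  have hMv := continuous_momentum_prod (n := n) hkc
  have mMv : ∀ l, Measurable fun p : Config n (Fin 3) T3 × T3 =>
      empiricalMomentumField p.1 (fun y => k (p.2 - y)) l :=
    fun l => ((PiLp.continuous_apply 2 _ l).comp hMv).measurable
  have mN := (continuous_norm.comp hMv).measurable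
  have mEn := (continuous_energy_prod (n := n) hkc).measurable
  have mP : ∀ i j, Measurable fun p : Config n (Fin 3) T3 × T3 =>
      Torus.partialDeriv j (fun y => φ y i) p.2 :=
    fun i j => ((StreamingStressCommutator.continuous_partialDeriv_apply hφ i j).comp
      continuous_snd).measurable
  have mdiv : Measurable fun p : Config n (Fin 3) T3 × T3 => Torus.divergence φ p.2 :=
    (hφ.divergence.continuous.comp continuous_snd).measurable
  dsimp only
  exact (Finset.measurable_sum _ fun i _ => Finset.measurable_sum _ fun j _ =>
    (((mMv i).mul (mMv j)).div mR).mul (mP i j)).add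
      ((mR.mul (measurable_const.mul ((mEn.div mR).sub ((mN.pow_const 2).div
        (measurable_const.mul (mR.pow_const 2)))))).mul mdiv)

/-- **The ideal-stress observable is measurable** in the configuration (parametric integral of a
jointly measurable integrand, `StronglyMeasurable.integral_prod_right'`). [folklore] -/
theorem measurable_idealObservable {n : ℕ} {k : T3 → ℝ} (hkc : Continuous k) {φ : T3 → V3}
    (hφ : Torus.IsSmooth φ) :
    Measurable fun w : Config n (Fin 3) T3 => ∫ x,
      (let R : ℝ := empiricalDensityField w (fun y => k (x - y))
      let Mv : V3 := empiricalMomentumField w (fun y => k (x - y))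
      let En : ℝ := empiricalEnergyField w (fun y => k (x - y))
      let Θ : ℝ := 2 / 3 * (En / R - ‖Mv‖ ^ 2 / (2 * R ^ 2))
      (∑ i, ∑ j, (Mv i * Mv j / R) * Torus.partialDeriv j (fun y => φ y i) x) +
        R * Θ * Torus.divergence φ x) :=
  ((measurable_idealIntegrand hkc hφ).stronglyMeasurable.integral_prod_right'
    (ν := (volume : Measure T3))).measurable

/-- The nine partial derivatives of a smooth vector field are uniformly bounded. [folklore] -/
theorem exists_forall_abs_partialDeriv_le {φ : T3 → V3} (hφ : Torus.IsSmooth φ) :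
    ∃ C : ℝ, 0 ≤ C ∧ ∀ i j x, |Torus.partialDeriv j (fun y => φ y i) x| ≤ C := by
  have hPc : Continuous fun x : T3 => fun i j : Fin 3 => Torus.partialDeriv j (fun y => φ y i) x :=
    continuous_pi fun i => continuous_pi fun j =>
      StreamingStressCommutator.continuous_partialDeriv_apply hφ i j
  obtain ⟨C, hC⟩ := isCompact_univ.exists_bound_of_continuousOn hPc.continuousOn
  refine ⟨max C 0, le_max_right _ _, fun i j x => ?_⟩
  have key : ∀ (Q : Fin 3 → Fin 3 → ℝ) (i j : Fin 3), |Q i j| ≤ ‖Q‖ := fun Q i j => by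
    rw [← Real.norm_eq_abs]
    exact (norm_le_pi_norm (Q i) j).trans (norm_le_pi_norm Q i)
  exact (key (fun i j => Torus.partialDeriv j (fun y => φ y i) x) i j).trans
    ((hC x (mem_univ x)).trans (le_max_left _ _))

/-! ### The local Gibbs law: good set, energy -/

/-- The local Gibbs law is carried by the good set of the flow (absolute continuity with respect
to the Liouville measure). [folklore] -/
theorem ae_mem_good_localGibbsLaw (σ : ℝ) (a₀ : T3 → ℝ) (u₀ : T3 → V3) (θ₀ : T3 → ℝ) (N : ℕ)
    (Φ : HardSphereFlow (Torus.geometry (Fin 3)) (hsDiameter σ N) (N + 1)) :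
    (∀ᵐ z ∂(localGibbsLaw σ a₀ u₀ θ₀ N Φ), z ∈ Φ.good) ∧ localGibbsLaw σ a₀ u₀ θ₀ N Φ Φ.goodᶜ = 0 := by
  have hPac : localGibbsLaw σ a₀ u₀ θ₀ N Φ ≪
      liouville (Torus.geometry (Fin 3)) (N + 1) (hsDiameter σ N) := by
    rw [localGibbsLaw_eq]
    exact localGibbsMeasure_absolutelyContinuous σ a₀ u₀ θ₀ N Φ
  exact ⟨hPac.ae_le Φ.ae_mem_good, hPac Φ.measure_compl_good⟩

/-- **The kinetic energy per particle `(N+1)⁻¹Σ_a‖v_a‖²` is integrable under the local Gibbs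
law** (`σ ≤ 1/2`, continuous profiles, `a₀, θ₀ > 0`; `integrable_avg_norm_sq_vel_flow` at time
`0`). [folklore] -/
theorem integrable_energy {σ : ℝ} (hσ : σ ≤ 1 / 2) {a₀ θ₀ : T3 → ℝ} {u₀ : T3 → V3}
    (ha : Continuous a₀) (hθ : Continuous θ₀) (hu : Continuous u₀) (ha0 : ∀ x, 0 < a₀ x)
    (hθ0 : ∀ x, 0 < θ₀ x) (N : ℕ)
    (Φ : HardSphereFlow (Torus.geometry (Fin 3)) (hsDiameter σ N) (N + 1)) :
    Integrable (fun z : Config (N + 1) (Fin 3) T3 => ((N + 1 : ℕ) : ℝ)⁻¹ * ∑ a, ‖(z a).2‖ ^ 2)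
      (localGibbsLaw σ a₀ u₀ θ₀ N Φ) := by
  have h := RestartPrinciple.AgeDuhamelForgetting.integrable_avg_norm_sq_vel_flow Φ ha hθ hu
    (fun x => (ha0 x).le) hθ0 (isProbabilityMeasure_localGibbsLaw ha hθ hu ha0 hθ0 hσ N Φ) 0
  refine h.congr ?_
  filter_upwards [(ae_mem_good_localGibbsLaw σ a₀ u₀ θ₀ N Φ).1] with z hz
  rw [Φ.flow_zero z hz]

/-- **The mean kinetic energy per particle is at most `3 sup θ₀ + sup ‖u₀‖²`** (Gaussian
velocities of the local Gibbs law; `lintegral_avg_norm_sq_vel_le`). [folklore] -/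
theorem integral_energy_le {σ : ℝ} (hσ : σ ≤ 1 / 2) {a₀ θ₀ : T3 → ℝ} {u₀ : T3 → V3}
    (ha : Continuous a₀) (hθ : Continuous θ₀) (hu : Continuous u₀) (ha0 : ∀ x, 0 < a₀ x)
    (hθ0 : ∀ x, 0 < θ₀ x) {B₁ : ℝ} (hB₁ : ∀ x, 3 * θ₀ x + ‖u₀ x‖ ^ 2 ≤ B₁) (N : ℕ)
    (Φ : HardSphereFlow (Torus.geometry (Fin 3)) (hsDiameter σ N) (N + 1)) :
    ∫ z, ((N + 1 : ℕ) : ℝ)⁻¹ * ∑ a, ‖(z a).2‖ ^ 2 ∂(localGibbsLaw σ a₀ u₀ θ₀ N Φ) ≤ B₁ := by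
  have hprob : IsProbabilityMeasure (localGibbsLaw σ a₀ u₀ θ₀ N Φ) :=
    isProbabilityMeasure_localGibbsLaw ha hθ hu ha0 hθ0 hσ N Φ
  have hc : 0 ≤ ((N + 1 : ℕ) : ℝ)⁻¹ := inv_nonneg.2 (Nat.cast_nonneg _)
  have hB₁0 : 0 ≤ B₁ :=
    le_trans (add_nonneg (mul_nonneg zero_le_three (hθ0 0).le) (sq_nonneg _)) (hB₁ 0)
  haveI : IsProbabilityMeasure (particleLaw Φ (canonicalDensity (Torus.geometry (Fin 3))
      (hsDiameter σ N) (N + 1) (localGibbsProfile a₀ u₀ θ₀))) := hprob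
  have hlin : ∫⁻ z, ENNReal.ofReal (((N + 1 : ℕ) : ℝ)⁻¹ * ∑ a, ‖(z a).2‖ ^ 2)
      ∂(localGibbsLaw σ a₀ u₀ θ₀ N Φ) ≤ ENNReal.ofReal B₁ :=
    NearConstantShortTimeHL.lintegral_avg_norm_sq_vel_le Φ ha hθ hu (fun x => (ha0 x).le) hθ0 hB₁
  rw [integral_eq_lintegral_of_nonneg_ae (ae_of_all _ fun z =>
    mul_nonneg hc (Finset.sum_nonneg fun a _ => sq_nonneg _))
    (integrable_energy hσ ha hθ hu ha0 hθ0 N Φ).aestronglyMeasurable]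
  exact ENNReal.toReal_le_of_le_ofReal hB₁0 hlin

/-- The mollified fields are shift covariant: the fields of `T_{−x} w` at the base point `0`
are the fields of `w` at `x`. [folklore] -/
theorem fields_translate {n : ℕ} (w : Config n (Fin 3) T3) (x : T3) (k : T3 → ℝ) :
    empiricalDensityField (fun i => ((w i).1 + -x, (w i).2) : Config n (Fin 3) T3)
        (fun y => k (0 - y)) = empiricalDensityField w (fun y => k (x - y)) ∧
      empiricalMomentumField (fun i => ((w i).1 + -x, (w i).2) : Config n (Fin 3) T3)
        (fun y => k (0 - y)) = empiricalMomentumField w (fun y => k (x - y)) ∧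
      empiricalEnergyField (fun i => ((w i).1 + -x, (w i).2) : Config n (Fin 3) T3)
        (fun y => k (0 - y)) = empiricalEnergyField w (fun y => k (x - y)) := by
  have key : ∀ a, (0 : T3) - ((w a).1 + -x) = x - (w a).1 := fun a => by abel
  simp only [empiricalDensityField_eq_sum, empiricalMomentumField_eq_sum,
    empiricalEnergyField_eq_sum, key, and_self]

/-- The mollified energy is dominated by the kinetic energy: `En ≤ (sup|k|/2) n⁻¹Σ_a‖v_a‖²`.
[folklore] -/
theorem energyField_le {n : ℕ} (w : Config n (Fin 3) T3) (x : T3) {k : T3 → ℝ} {Kk : ℝ}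
    (hKk : ∀ y, |k y| ≤ Kk) :
    empiricalEnergyField w (fun y => k (x - y)) ≤ Kk / 2 * ((n : ℝ)⁻¹ * ∑ a, ‖(w a).2‖ ^ 2) := by
  rw [empiricalEnergyField_eq_sum]
  have hc : 0 ≤ (n : ℝ)⁻¹ := inv_nonneg.2 (Nat.cast_nonneg n)
  calc (n : ℝ)⁻¹ * ∑ a, k (x - (w a).1) * (‖(w a).2‖ ^ 2 / 2)
      ≤ (n : ℝ)⁻¹ * ∑ a, Kk * (‖(w a).2‖ ^ 2 / 2) :=
        mul_le_mul_of_nonneg_left (Finset.sum_le_sum fun a _ => mul_le_mul_of_nonneg_right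
          ((le_abs_self _).trans (hKk _)) (by positivity)) hc
    _ = Kk / 2 * ((n : ℝ)⁻¹ * ∑ a, ‖(w a).2‖ ^ 2) := by
        rw [← Finset.mul_sum, ← Finset.sum_div]
        ring

/-- **Window integrals of energy-dominated observables along the flow are integrable** under the
local Gibbs law: for measurable `G` with `|G(w)| ≤ K (N+1)⁻¹Σ_a‖v_a‖²`,
`z ↦ ∫_{t₁}^{t₂} G(Φ_s z) ds` is a.e.-measurable
(`HardSphereFlow.aemeasurable_intervalIntegral_comp_flow_torus`) and bounded by
`K |t₂ − t₁| (N+1)⁻¹Σ_a‖v_a(0)‖²` on the good set (energy conservation). [folklore] -/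
theorem integrable_window_flow {σ : ℝ} (hσ : σ ≤ 1 / 2) {a₀ θ₀ : T3 → ℝ} {u₀ : T3 → V3}
    (ha : Continuous a₀) (hθ : Continuous θ₀) (hu : Continuous u₀) (ha0 : ∀ x, 0 < a₀ x)
    (hθ0 : ∀ x, 0 < θ₀ x) {N : ℕ}
    (Φ : HardSphereFlow (Torus.geometry (Fin 3)) (hsDiameter σ N) (N + 1))
    {G : Config (N + 1) (Fin 3) T3 → ℝ} (hGm : Measurable G) {K : ℝ}
    (hGle : ∀ w, |G w| ≤ K * (((N + 1 : ℕ) : ℝ)⁻¹ * ∑ a, ‖(w a).2‖ ^ 2)) (t₁ t₂ : ℝ) :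
    Integrable (fun z => ∫ s in t₁..t₂, G (Φ.flow s z)) (localGibbsLaw σ a₀ u₀ θ₀ N Φ) := by
  obtain ⟨hgood, hgood'⟩ := ae_mem_good_localGibbsLaw σ a₀ u₀ θ₀ N Φ
  refine Integrable.mono' (((integrable_energy hσ ha hθ hu ha0 hθ0 N Φ).const_mul K).mul_const
    |t₂ - t₁|) (Φ.aemeasurable_intervalIntegral_comp_flow_torus hGm t₁ t₂ hgood').aestronglyMeasurable
    ?_
  filter_upwards [hgood] with z hz
  exact intervalIntegral.norm_integral_le_of_norm_le_const fun s _ => by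
    rw [Real.norm_eq_abs, ← sum_norm_sq_vel_flow Φ hz s]
    exact hGle _

/-! ### The window functional along a good orbit -/

/-- **Pathwise bound for the stub's functional over a window.** Along the orbit of a good datum,
`|∫_{t₁}^{t₂} T ds − ∫_{t₁}^{t₂} J ds| ≤ 19 C (t₂ − t₁) n⁻¹ Σ_a ‖v_a(0)‖²` (the two observables are
dominated by `9C` resp. `10C` times the conserved kinetic energy `n⁻¹Σ_a‖v_a(s)‖² = n⁻¹Σ_a‖v_a(0)‖²`;
no measurability in time is needed for the bound). [folklore] -/
theorem abs_window_le {n : ℕ} {ε : ℝ} (Φ : HardSphereFlow (Torus.geometry (Fin 3)) ε n)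
    {φ : T3 → V3} {C : ℝ} (hC : ∀ i j y, |Torus.partialDeriv j (fun y => φ y i) y| ≤ C)
    {k : T3 → ℝ} (hkc : Continuous k) (hk0 : ∀ y, 0 ≤ k y) (hk1 : ∫ y, k y = 1)
    {z : Config n (Fin 3) T3} (hz : z ∈ Φ.good) {t₁ t₂ : ℝ} (h₁₂ : t₁ ≤ t₂) :
    |(∫ s in t₁..t₂, ∫ x, (n : ℝ)⁻¹ * ∑ a, k (x - (Φ.flow s z a).1) *
        (∑ i, ∑ j, (Φ.flow s z a).2 i * (Φ.flow s z a).2 j *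
          Torus.partialDeriv j (fun y => φ y i) x)) -
      (∫ s in t₁..t₂, ∫ x, (let R : ℝ := empiricalDensityField (Φ.flow s z) (fun y => k (x - y))
        let Mv : V3 := empiricalMomentumField (Φ.flow s z) (fun y => k (x - y))
        let En : ℝ := empiricalEnergyField (Φ.flow s z) (fun y => k (x - y))
        let Θ : ℝ := 2 / 3 * (En / R - ‖Mv‖ ^ 2 / (2 * R ^ 2))
        (∑ i, ∑ j, (Mv i * Mv j / R) * Torus.partialDeriv j (fun y => φ y i) x) +
          R * Θ * Torus.divergence φ x))| ≤
      19 * C * (t₂ - t₁) * ((n : ℝ)⁻¹ * ∑ a, ‖(z a).2‖ ^ 2) := by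
  have hc : 0 ≤ (n : ℝ)⁻¹ := inv_nonneg.2 (Nat.cast_nonneg n)
  set E₀ : ℝ := (n : ℝ)⁻¹ * ∑ a, ‖(z a).2‖ ^ 2 with hE₀
  have hT := intervalIntegral.norm_integral_le_of_norm_le_const (a := t₁) (b := t₂)
    (C := 9 * C * E₀) (f := fun s => ∫ x, (n : ℝ)⁻¹ * ∑ a, k (x - (Φ.flow s z a).1) *
      (∑ i, ∑ j, (Φ.flow s z a).2 i * (Φ.flow s z a).2 j *
        Torus.partialDeriv j (fun y => φ y i) x)) fun s _ => by
      rw [Real.norm_eq_abs, hE₀, ← sum_norm_sq_vel_flow Φ hz s]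
      exact abs_integral_stressIntegrand_le (Φ.flow s z) hkc hk0 hk1 hC hc
  have hJ := intervalIntegral.norm_integral_le_of_norm_le_const (a := t₁) (b := t₂)
    (C := 10 * C * E₀) (f := fun s => ∫ x,
      (let R : ℝ := empiricalDensityField (Φ.flow s z) (fun y => k (x - y))
      let Mv : V3 := empiricalMomentumField (Φ.flow s z) (fun y => k (x - y))
      let En : ℝ := empiricalEnergyField (Φ.flow s z) (fun y => k (x - y))
      let Θ : ℝ := 2 / 3 * (En / R - ‖Mv‖ ^ 2 / (2 * R ^ 2))
      (∑ i, ∑ j, (Mv i * Mv j / R) * Torus.partialDeriv j (fun y => φ y i) x) +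
        R * Θ * Torus.divergence φ x)) fun s _ => by
      rw [Real.norm_eq_abs, hE₀, ← sum_norm_sq_vel_flow Φ hz s]
      exact abs_integral_idealIntegrand_le (Φ.flow s z) hkc hk0 hk1 hC
  rw [Real.norm_eq_abs, abs_of_nonneg (sub_nonneg.2 h₁₂)] at hT hJ
  refine (abs_sub _ _).trans ?_
  calc _ ≤ 9 * C * E₀ * (t₂ - t₁) + 10 * C * E₀ * (t₂ - t₁) := add_le_add hT hJ
    _ = 19 * C * (t₂ - t₁) * E₀ := by ring

end DeviatoricStressClosure

open DeviatoricStressClosure in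
/-- **Registered sub-goal `stub_deviatoricStressClosure_integrable` of stub KS-b: the integrability
conjunct at every `N`, with a uniform mean bound.** For
`σ ≤ 1/2`, continuous profiles `a₀ > 0`, `θ₀ > 0`, `u₀` with `3θ₀ + ‖u₀‖² ≤ B₁`, every `N`, every
hard-sphere flow `Φ`, every window `t₁ ≤ t₂`, every vector field `φ` with `|∂_jφ_i| ≤ C`, and every
continuous probability kernel `k ≥ 0`, the stub's functional
`D(z) = ∫_{t₁}^{t₂}∫_x (N+1)⁻¹Σ_a k(x−x_a(s)) Σ_ij v_a^iv_a^j ∂_jφ_i dx ds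
       − ∫_{t₁}^{t₂}∫_x [Σ_ij (Mv_iMv_j/R)∂_jφ_i + RΘ div φ] dx ds`
(as in `stub_deviatoricStressClosure` with `Φ` for `Φ N` and the `let`-bound mollified fields written
out — definitionally equal to the stub's `D`) is integrable under
the local Gibbs law `localGibbsLaw σ a₀ u₀ θ₀ N Φ` and `|E D| ≤ 19 C (t₂ − t₁) B₁`.
Proof: pathwise `|D z| ≤ 19C(t₂ − t₁)(N+1)⁻¹Σ_a‖v_a(0)‖²` on the good set (`abs_window_le`:
Cauchy–Schwarz bounds of both observables by the conserved kinetic energy), the good set is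
conull (absolute continuity of the local Gibbs law), `D` is a.e.-measurable (window integrals of
the continuous stress observable and of the measurable ideal-stress observable along the flow,
`HardSphereFlow.aemeasurable_intervalIntegral_comp_flow_torus`), and
`E (N+1)⁻¹Σ_a‖v_a‖² ≤ 3 sup θ₀ + sup‖u₀‖² ≤ B₁` (`integrable_avg_norm_sq_vel_flow`,
`lintegral_avg_norm_sq_vel_le`). Integrability is therefore NOT the issue of stub KS-b; its
content is the smallness of the mean (isotropy in mean of the scale-`ℓ` peculiar stress,
`stubIntegrand_sub_eq_deviatoric`). [folklore] -/
theorem stub_deviatoricStressClosure_integrable : ∀ (σ : ℝ), σ ≤ 1 / 2 → ∀ (a₀ θ₀ : Literature.MathematicalPhysics.KineticTheory.T3 → ℝ) (u₀ : Literature.MathematicalPhysics.KineticTheory.T3 → Literature.MathematicalPhysics.KineticTheory.V3), Continuous a₀ → Continuous θ₀ → Continuous u₀ → (∀ x, 0 < a₀ x) → (∀ x, 0 < θ₀ x) → ∀ (B₁ : ℝ), (∀ x, 3 * θ₀ x + ‖u₀ x‖ ^ 2 ≤ B₁) → ∀ (N : ℕ) (Φ : Literature.Analysis.FluidPDE.HardSphereFlow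 (Literature.Analysis.FluidPDE.Torus.geometry (Fin 3)) (Literature.MathematicalPhysics.KineticTheory.hsDiameter σ N) (N + 1)) (t₁ t₂ : ℝ), t₁ ≤ t₂ → ∀ (φ : Literature.MathematicalPhysics.KineticTheory.T3 → Literature.MathematicalPhysics.KineticTheory.V3), Literature.Analysis.FunctionSpaces.Torus.IsSmooth φ → ∀ (C : ℝ), (∀ (i j : Fin 3) (y : Literature.MathematicalPhysics.KineticTheory.T3), |Literature.Analysis.FunctionSpaces.Torus.partialDeriv j (fun y => φ y i) y| ≤ C) → ∀ (k : Literature.MathematicalPhysics.KineticTheory.T3 → ℝ), Continuous k → (∀ y, 0 ≤ k y) → (∫ y, k y = 1) → ∀ D : Literature.Analysis.FluidPDE.Config (N + 1) (Fin 3) Literature.MathematicalPhysics.KineticTheory.T3 → ℝ, D = (fun z => (∫ s in t₁..t₂, ∫ x, ((N + 1 : ℕ) : ℝ)⁻¹ * ∑ a, k (x - (Φ.flow s z a).1) * (∑ i, ∑ j, (Φ.flow s z a).2 i * (Φ.flow s z a).2 j * Literature.Analysis.FunctionSpaces.Torus.partialDeriv j (fun y => φ y i) x)) - (∫ s in t₁..t₂,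 ∫ x, ((∑ i, ∑ j, (Literature.MathematicalPhysics.KineticTheory.empiricalMomentumField (Φ.flow s z) (fun y => k (x - y)) i * Literature.MathematicalPhysics.KineticTheory.empiricalMomentumField (Φ.flow s z) (fun y => k (x - y)) j / Literature.MathematicalPhysics.KineticTheory.empiricalDensityField (Φ.flow s z) (fun y => k (x - y))) * Literature.Analysis.FunctionSpaces.Torus.partialDeriv j (fun y => φ y i) x) + Literature.MathematicalPhysics.KineticTheory.empiricalDensityField (Φ.flow s z) (fun y => k (x - y)) * (2 / 3 * (Literature.MathematicalPhysics.KineticTheory.empiricalEnergyField (Φ.flow s z) (fun y => k (x - y)) / Literature.MathematicalPhysics.KineticTheory.empiricalDensityField (Φ.flow s z) (fun y => k (x - y)) - ‖Literature.MathematicalPhysics.KineticTheory.empiricalMomentumField (Φ.flow s z) (fun y => k (x - y))‖ ^ 2 / (2 * Literature.MathematicalPhysics.KineticTheory.empiricalDensityField (Φ.flow s z) (fun y => k (x - y)) ^ 2))) * Literature.Analysis.FunctionSpaces.Torus.divergence φ x))) → MeasureTheory.Integrable D (Literature.MathematicalPhysics.KineticTheory.localGibbsLaw σ a₀ u₀ θ₀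 N Φ) ∧ |∫ z, D z ∂Literature.MathematicalPhysics.KineticTheory.localGibbsLaw σ a₀ u₀ θ₀ N Φ| ≤ 19 * C * (t₂ - t₁) * B₁ := by
  intro σ hσ a₀ θ₀ u₀ ha hθ hu ha0 hθ0 B₁ hB₁ N Φ t₁ t₂ h₁₂ φ hφ C hC k hkc hk0 hk1 D hD
  set μ := localGibbsLaw σ a₀ u₀ θ₀ N Φ with hμ
  obtain ⟨hgood, hgood'⟩ := ae_mem_good_localGibbsLaw σ a₀ u₀ θ₀ N Φ
  set c : ℝ := ((N + 1 : ℕ) : ℝ)⁻¹ with hcdef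
  -- the dominating energy functional, integrable with mean `≤ B₁`
  have hEint := integrable_energy hσ ha hθ hu ha0 hθ0 N Φ
  have hEmean := integral_energy_le hσ ha hθ hu ha0 hθ0 hB₁ N Φ
  -- measurability of the functional (window integrals of measurable observables along the flow)
  have hI₁ : AEMeasurable (fun z => ∫ s in t₁..t₂, ∫ x, c * ∑ a, k (x - (Φ.flow s z a).1) *
      (∑ i, ∑ j, (Φ.flow s z a).2 i * (Φ.flow s z a).2 j *
        Torus.partialDeriv j (fun y => φ y i) x)) μ :=
    Φ.aemeasurable_intervalIntegral_comp_flow_torus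
      (f := fun w => ∫ x, c * ∑ a, k (x - (w a).1) *
        (∑ i, ∑ j, (w a).2 i * (w a).2 j * Torus.partialDeriv j (fun y => φ y i) x))
      (StreamingStressCommutator.continuous_mollifiedStress hφ hkc c).measurable t₁ t₂ hgood'
  have hI₂ : AEMeasurable (fun z => ∫ s in t₁..t₂, ∫ x,
      (let R : ℝ := empiricalDensityField (Φ.flow s z) (fun y => k (x - y))
      let Mv : V3 := empiricalMomentumField (Φ.flow s z) (fun y => k (x - y))
      let En : ℝ := empiricalEnergyField (Φ.flow s z) (fun y => k (x - y))
      let Θ : ℝ := 2 / 3 * (En / R - ‖Mv‖ ^ 2 / (2 * R ^ 2))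
      (∑ i, ∑ j, (Mv i * Mv j / R) * Torus.partialDeriv j (fun y => φ y i) x) +
        R * Θ * Torus.divergence φ x)) μ :=
    Φ.aemeasurable_intervalIntegral_comp_flow_torus
      (f := fun w => ∫ x,
        (let R : ℝ := empiricalDensityField w (fun y => k (x - y))
        let Mv : V3 := empiricalMomentumField w (fun y => k (x - y))
        let En : ℝ := empiricalEnergyField w (fun y => k (x - y))
        let Θ : ℝ := 2 / 3 * (En / R - ‖Mv‖ ^ 2 / (2 * R ^ 2))
        (∑ i, ∑ j, (Mv i * Mv j / R) * Torus.partialDeriv j (fun y => φ y i) x) +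
          R * Θ * Torus.divergence φ x))
      (measurable_idealObservable hkc hφ) t₁ t₂ hgood'
  have hDm : AEStronglyMeasurable D μ := by
    rw [hD]
    exact (hI₁.sub hI₂).aestronglyMeasurable
  -- the pathwise bound, almost surely
  have hDle : ∀ᵐ z ∂μ, ‖D z‖ ≤ 19 * C * (t₂ - t₁) * (c * ∑ a, ‖(z a).2‖ ^ 2) := by
    filter_upwards [hgood] with z hz
    rw [hD, Real.norm_eq_abs]
    exact abs_window_le Φ hC hkc hk0 hk1 hz h₁₂
  have hDint : Integrable D μ := Integrable.mono' (hEint.const_mul _) hDm hDle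
  refine ⟨hDint, ?_⟩
  have hC0 : 0 ≤ C := (abs_nonneg _).trans (hC 0 0 0)
  have h19 : 0 ≤ 19 * C * (t₂ - t₁) := by
    have : 0 ≤ t₂ - t₁ := sub_nonneg.2 h₁₂
    positivity
  calc |∫ z, D z ∂μ| ≤ ∫ z, |D z| ∂μ := abs_integral_le_integral_abs
    _ ≤ ∫ z, 19 * C * (t₂ - t₁) * (c * ∑ a, ‖(z a).2‖ ^ 2) ∂μ := by
        refine integral_mono_ae hDint.abs (hEint.const_mul _) ?_
        filter_upwards [hDle] with z hz
        rwa [Real.norm_eq_abs] at hz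
    _ = 19 * C * (t₂ - t₁) * ∫ z, c * ∑ a, ‖(z a).2‖ ^ 2 ∂μ := integral_const_mul _ _
    _ ≤ 19 * C * (t₂ - t₁) * B₁ := mul_le_mul_of_nonneg_left hEmean h19

end Summit.AtomisticToContinuum.HydrodynamicLimit.Theorems

end
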